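/-
Copyright (c) 2026. All rights reserved.
Released under Apache 2.0 license as described in the file LICENSE.
-/
import Summits.ValiantsHypothesis.ValiantsHypothesis.Theorems.MinimumPerfectMatchingFace
import Summits.ValiantsHypothesis.ValiantsHypothesis.Theorems.RelationGraphCycles

/-!
# One isolation round: the minimum face, girth doubling and the hash family of a round

Stage S4b-i of the O-L2-14 isolation series (S1 `SuccinctCirculationHashing`, S2
`MinimumPerfectMatchingFace`, S3 `ShortCyclePatterns`, S4a `RelationGraphCycles`), after
[cite: FennerGurjarThierauf2016, Section 3].  Permutations `σ` of `Fin r` with `∀ k, G k (σ k)` are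
the `G`-ADMISSIBLE ones (= perfect matchings of `relGraph G`).
* §1 MINIMUM FACE `nextRel G W` (some `W`-minimum `G`-admissible permutation maps `i ↦ j`) and the
  FACE PROPERTY `adm_nextRel_iff` (S2's `face_orthogonal` applied to `P_σ - P_{σ₀}`).
* §2 GIRTH DOUBLING `girth_nextRel`: if `W` is non-orthogonal to the dart matrix (S4a) of every
  cycle of `relGraph G` of length `≤ 4L`, then `relGraph (nextRel G W)` has no such cycle.
* §3 LABELS: `labPat lab D μ` sums the entries of `D` labelled `μ`; `sum_labPat_mul` transports
  `Σ_{ij} D i j · w (lab i j)` to S1's currency `Σ_μ π μ · w μ`; READ-ONCE labellings (`hlab`) lose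
  nothing (`labPat_apply_lab`).
* §4 THE HASH FAMILY OF A ROUND `famPat G lab L` (non-zero, height-`≤ 1` label patterns of S3's
  short-cycle family; at most `(r + r) ^ 4`) and ONE ROUND `exists_round`: an oracle answering every
  such family with GOOD small non-orthogonal weights (S4c: S1's succinct hashing) yields good
  variable weights `w` whose induced edge weights `labWt lab w` double the girth bound.
Currency: kernel-certified helper for the W4 isolation road (S4b-ii iterates the round); closes no
item; data defs `nextRel`, `labWt`, `labPat`, `famPat`; no facts/doors.
-/

set_option linter.dupNamespace false

namespace Summit.ValiantsHypothesis.ValiantsHypothesis.Theorems.IsolationRoundStep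

open SimpleGraph Summit.ValiantsHypothesis.ValiantsHypothesis.Theorems.ShortCyclePatterns
  Summit.ValiantsHypothesis.ValiantsHypothesis.Theorems.RelationGraphCycles
  Summit.ValiantsHypothesis.ValiantsHypothesis.Theorems.MinimumPerfectMatchingFace

/-! ### §1 The minimum face of a weighting -/

section Face

variable {r : ℕ}

/-- The MINIMUM FACE relation: `nextRel G W i j` iff some `W`-minimum `G`-admissible permutation
maps `i ↦ j` (the `hD` datum of S2's `face_orthogonal`, with `ℕ`-weights).
[folklore] [cite: FennerGurjarThierauf2016, Lemma 3.2] -/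
def nextRel (G : Fin r → Fin r → Prop) (W : Fin r → Fin r → ℕ) : Fin r → Fin r → Prop :=
  fun i j => ∃ σ : Equiv.Perm (Fin r), σ i = j ∧ (∀ k, G k (σ k)) ∧
    ∀ τ : Equiv.Perm (Fin r), (∀ k, G k (τ k)) → ∑ k, W k (σ k) ≤ ∑ k, W k (τ k)

/-- The minimum face refines `G`. -/
theorem nextRel_le (G : Fin r → Fin r → Prop) (W : Fin r → Fin r → ℕ) {i j : Fin r}
    (h : nextRel G W i j) : G i j := by
  obtain ⟨σ, rfl, hσ, -⟩ := h; exact hσ i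

/-- A `W`-minimum `G`-admissible permutation is admissible for the minimum face. -/
theorem adm_nextRel_of_min {G : Fin r → Fin r → Prop} {W : Fin r → Fin r → ℕ}
    {σ : Equiv.Perm (Fin r)} (hσ : ∀ k, G k (σ k))
    (hmin : ∀ τ : Equiv.Perm (Fin r), (∀ k, G k (τ k)) → ∑ k, W k (σ k) ≤ ∑ k, W k (τ k)) :
    ∀ k, nextRel G W k (σ k) :=
  fun _ => ⟨σ, rfl, hσ, hmin⟩

/-- A non-empty admissible set has a `W`-minimum element. -/
theorem exists_min_adm (G : Fin r → Fin r → Prop) (W : Fin r → Fin r → ℕ)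
    {σ : Equiv.Perm (Fin r)} (hσ : ∀ k, G k (σ k)) :
    ∃ σ₀ : Equiv.Perm (Fin r), (∀ k, G k (σ₀ k)) ∧
      ∀ τ : Equiv.Perm (Fin r), (∀ k, G k (τ k)) → ∑ k, W k (σ₀ k) ≤ ∑ k, W k (τ k) := by
  classical
  obtain ⟨σ₀, h₀, hmin⟩ := Finset.exists_min_image
    (Finset.univ.filter fun ρ : Equiv.Perm (Fin r) => ∀ k, G k (ρ k)) (fun ρ => ∑ k, W k (ρ k))
    ⟨σ, Finset.mem_filter.2 ⟨Finset.mem_univ _, hσ⟩⟩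
  exact ⟨σ₀, (Finset.mem_filter.1 h₀).2, fun τ hτ =>
    hmin τ (Finset.mem_filter.2 ⟨Finset.mem_univ _, hτ⟩)⟩

/-- `Σ_{i j} [σ i = j] · W i j = Σ_k W k (σ k)` (in `ℤ`). -/
theorem sum_sum_ite_mul_cast (W : Fin r → Fin r → ℕ) (σ : Equiv.Perm (Fin r)) :
    ∑ i, ∑ j, (if σ i = j then (1 : ℤ) else 0) * (W i j : ℤ) = ∑ k, (W k (σ k) : ℤ) := by
  refine Finset.sum_congr rfl fun i _ => ?_
  rw [Finset.sum_eq_single_of_mem (σ i) (Finset.mem_univ _)]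
  · rw [if_pos rfl, one_mul]
  · intro j _ hj
    rw [if_neg (Ne.symm hj), zero_mul]

/-- FACE PROPERTY: the permutations admissible for the minimum face `nextRel G W` are exactly the
`W`-minimum `G`-admissible permutations (S2's `face_orthogonal` applied to `D = P_σ - P_{σ₀}`).
[cite: FennerGurjarThierauf2016, Lemma 3.2] -/
theorem adm_nextRel_iff {G : Fin r → Fin r → Prop} {W : Fin r → Fin r → ℕ}
    {σ : Equiv.Perm (Fin r)} :
    (∀ k, nextRel G W k (σ k)) ↔ (∀ k, G k (σ k)) ∧
      ∀ τ : Equiv.Perm (Fin r), (∀ k, G k (τ k)) → ∑ k, W k (σ k) ≤ ∑ k, W k (τ k) := by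
  refine ⟨fun hσ => ?_, fun h => adm_nextRel_of_min h.1 h.2⟩
  have hσG : ∀ k, G k (σ k) := fun k => nextRel_le G W (hσ k)
  obtain ⟨σ₀, hσ₀G, hmin₀⟩ := exists_min_adm G W hσG
  refine ⟨hσG, fun τ hτ => ?_⟩
  suffices h : ∑ k, (W k (σ k) : ℤ) = ∑ k, (W k (σ₀ k) : ℤ) by
    have h' : ∑ k, W k (σ k) = ∑ k, W k (σ₀ k) := by exact_mod_cast h
    rw [h']
    exact hmin₀ τ hτ
  obtain ⟨D, hD⟩ : ∃ D : Matrix (Fin r) (Fin r) ℤ, ∀ i j,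
      D i j = (if σ i = j then (1 : ℤ) else 0) - (if σ₀ i = j then (1 : ℤ) else 0) :=
    ⟨Matrix.of fun i j => (if σ i = j then (1 : ℤ) else 0) - (if σ₀ i = j then (1 : ℤ) else 0),
      fun _ _ => rfl⟩
  have hrow : ∀ i, ∑ j, D i j = 0 := fun i => by
    simp only [hD, Finset.sum_sub_distrib, Finset.sum_ite_eq, Finset.mem_univ, if_true, sub_self]
  have hcol : ∀ j, ∑ i, D i j = 0 := fun j => by
    simp only [hD, Finset.sum_sub_distrib]
    simp_rw [Equiv.apply_eq_iff_eq_symm_apply]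
    simp
  have hDs : ∀ i j, D i j ≠ 0 → ∃ ρ : Equiv.Perm (Fin r), ρ i = j ∧ (∀ k, G k (ρ k)) ∧
      ∀ τ : Equiv.Perm (Fin r), (∀ k, G k (τ k)) →
        ∑ k, (W k (ρ k) : ℤ) ≤ ∑ k, (W k (τ k) : ℤ) := by
    intro i j hij
    by_cases h1 : σ i = j
    · obtain ⟨ρ, hρi, hρG, hρmin⟩ := hσ i
      exact ⟨ρ, hρi.trans h1, hρG, fun τ hτ => by exact_mod_cast hρmin τ hτ⟩
    · by_cases h2 : σ₀ i = j
      · exact ⟨σ₀, h2, hσ₀G, fun τ hτ => by exact_mod_cast hmin₀ τ hτ⟩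
      · exact absurd (by rw [hD, if_neg h1, if_neg h2, sub_self]) hij
  have hface := face_orthogonal G (fun i j => (W i j : ℤ)) D hrow hcol hDs
  have hsplit : ∑ i, ∑ j, D i j * (W i j : ℤ) = ∑ k, (W k (σ k) : ℤ) - ∑ k, (W k (σ₀ k) : ℤ) := by
    simp only [hD, sub_mul, Finset.sum_sub_distrib, sum_sum_ite_mul_cast]
  rw [hsplit] at hface
  exact sub_eq_zero.1 hface

/-! ### §2 Girth doubling -/

/-- GIRTH DOUBLING (cycle elimination).  If the weighting `W` is non-orthogonal to the dart matrix
of every cycle of `relGraph G` of length `≤ 4L`, then the minimum-face graph of `nextRel G W` has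
no cycle of length `≤ 4L`: such a cycle maps into `relGraph G`, and its dart matrix satisfies the
hypotheses of S2's `face_orthogonal` for the face `nextRel G W` (used with girth `> 2L`, whence the
name).  [cite: FennerGurjarThierauf2016, Lemma 3.3 and Corollary 3.4] -/
theorem girth_nextRel {G : Fin r → Fin r → Prop} (W : Fin r → Fin r → ℕ) {L : ℕ}
    (hW : ∀ (u : Fin r ⊕ Fin r) (c : (relGraph G).Walk u u), c.IsCycle → c.length ≤ 4 * L →
      ∑ i, ∑ j, walkSum dartMat c i j * (W i j : ℤ) ≠ 0) :
    ∀ (u : Fin r ⊕ Fin r) (c : (relGraph (nextRel G W)).Walk u u), c.IsCycle →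
      4 * L < c.length := by
  intro u c hc
  by_contra hle
  push Not at hle
  have hsub : relGraph (nextRel G W) ≤ relGraph G := relGraph_mono fun i j h => nextRel_le G W h
  have hc' : (c.mapLe hsub).IsCycle := (Walk.isCycle_mapLe hsub).2 hc
  have hlen : (c.mapLe hsub).length = c.length := Walk.length_map (Hom.ofLE hsub) c
  refine hW u (c.mapLe hsub) hc' (by rw [hlen]; exact hle) ?_
  rw [walkSum_mapLe]
  exact face_orthogonal G (fun i j => (W i j : ℤ)) (walkSum dartMat c)
    (sum_walkSum_dartMat_row c) (sum_walkSum_dartMat_col c) fun i j h => by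
      obtain ⟨ρ, hρi, hρG, hρmin⟩ := rel_of_walkSum_dartMat_ne_zero c h
      exact ⟨ρ, hρi, hρG, fun τ hτ => by exact_mod_cast hρmin τ hτ⟩

end Face

/-! ### §3 Labels: from edge weights to variable weights -/

section Labels

variable {α β M : Type*}

/-- Edge weights induced by variable weights through a labelling: `labWt lab w i j = w (lab i j)`.
[folklore] -/
def labWt (lab : α → β → M) (w : M → ℕ) : α → β → ℕ := fun i j => w (lab i j)

/-- Unfolding `labWt`. -/
@[simp] theorem labWt_apply (lab : α → β → M) (w : M → ℕ) (i : α) (j : β) :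
    labWt lab w i j = w (lab i j) := rfl

variable [Fintype α] [Fintype β] [DecidableEq M]

/-- The LABEL PATTERN of a matrix: `labPat lab D μ = Σ_{lab i j = μ} D i j`. [folklore] -/
def labPat (lab : α → β → M) (D : Matrix α β ℤ) (μ : M) : ℤ :=
  ∑ i, ∑ j, if lab i j = μ then D i j else 0

/-- Transport of the pairing to the variable currency of S1:
`Σ_μ (labPat lab D μ) · w μ = Σ_{i j} D i j · w (lab i j)`. -/
theorem sum_labPat_mul [Fintype M] (lab : α → β → M) (D : Matrix α β ℤ) (w : M → ℤ) :
    ∑ μ, labPat lab D μ * w μ = ∑ i, ∑ j, D i j * w (lab i j) := by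
  simp only [labPat, Finset.sum_mul, ite_mul, zero_mul]
  rw [Finset.sum_comm]
  refine Finset.sum_congr rfl fun i _ => ?_
  rw [Finset.sum_comm]
  refine Finset.sum_congr rfl fun j _ => ?_
  simp only [Finset.sum_ite_eq, Finset.mem_univ, if_true]

/-- A label absent from the support of `D` has pattern value `0`. -/
theorem labPat_eq_zero {lab : α → β → M} {D : Matrix α β ℤ} {μ : M}
    (h : ∀ i j, lab i j = μ → D i j = 0) : labPat lab D μ = 0 := by
  refine Finset.sum_eq_zero fun i _ => Finset.sum_eq_zero fun j _ => ?_
  split_ifs with hij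
  exacts [h i j hij, rfl]

/-- READ-ONCE labellings lose nothing: if `lab` is injective on a relation `G₀` containing the
support of `D`, then `labPat lab D (lab i j) = D i j` on the support. -/
theorem labPat_apply_lab {G₀ : α → β → Prop} {lab : α → β → M}
    (hlab : ∀ i j i' j', G₀ i j → G₀ i' j' → lab i j = lab i' j' → i = i' ∧ j = j')
    {D : Matrix α β ℤ} (hsupp : ∀ i j, D i j ≠ 0 → G₀ i j) {i : α} {j : β} (hij : D i j ≠ 0) :
    labPat lab D (lab i j) = D i j := by
  have hvan : ∀ i' j', ¬ (i' = i ∧ j' = j) →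
      (if lab i' j' = lab i j then D i' j' else 0) = 0 := by
    intro i' j' hne
    split_ifs with h
    exacts [Classical.by_contradiction fun hD =>
      hne (hlab i' j' i j (hsupp i' j' hD) (hsupp i j hij) h), rfl]
  unfold labPat
  rw [Finset.sum_eq_single_of_mem i (Finset.mem_univ i)]
  · rw [Finset.sum_eq_single_of_mem j (Finset.mem_univ j)]
    · rw [if_pos rfl]
    · intro j' _ hj'
      exact hvan i j' fun h => hj' h.2
  · intro i' _ hi'
    exact Finset.sum_eq_zero fun j' _ => hvan i' j' fun h => hi' h.1

end Labels

/-! ### §4 The hash family of a round, and one round -/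

section Round

variable {M : Type*} [Fintype M] [DecidableEq M] {r : ℕ}

/-- The HASH FAMILY of a round: the label patterns of S3's short-cycle family of `relGraph G` at
scale `L` that are non-zero with all entries in `{-1, 0, 1}`. [cite: FennerGurjarThierauf2016,
Lemma 3.5] -/
noncomputable def famPat (G : Fin r → Fin r → Prop) (lab : Fin r → Fin r → M) (L : ℕ) :
    Finset (M → ℤ) :=
  ((shortCycleFamily (relGraph G) dartMat L).image (labPat lab)).filter
    fun π => π ≠ 0 ∧ ∀ μ, (π μ).natAbs ≤ 1

/-- The hash family of a round has at most `(r + r) ^ 4` members (S3). -/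
theorem card_famPat_le (G : Fin r → Fin r → Prop) (lab : Fin r → Fin r → M) (L : ℕ) :
    (famPat G lab L).card ≤ (r + r) ^ 4 := by
  have h := card_shortCycleFamily_le (relGraph G) dartMat L
  rw [Fintype.card_sum, Fintype.card_fin] at h
  unfold famPat
  exact (Finset.card_filter_le _ _).trans (Finset.card_image_le.trans h)

/-- Members of the hash family are non-zero. -/
theorem ne_zero_of_mem_famPat {G : Fin r → Fin r → Prop} {lab : Fin r → Fin r → M} {L : ℕ}
    {π : M → ℤ} (h : π ∈ famPat G lab L) : π ≠ 0 := by
  unfold famPat at h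
  exact (Finset.mem_filter.1 h).2.1

/-- Members of the hash family have height `≤ 1`. -/
theorem natAbs_le_of_mem_famPat {G : Fin r → Fin r → Prop} {lab : Fin r → Fin r → M} {L : ℕ}
    {π : M → ℤ} (h : π ∈ famPat G lab L) (μ : M) : (π μ).natAbs ≤ 1 := by
  unfold famPat at h
  exact (Finset.mem_filter.1 h).2.2 μ

/-- The label pattern of a cycle of length `≤ 4L` in `relGraph G` (`G` inside the read-once
relation `G₀`, girth of `relGraph G` above `2L`) belongs to the hash family. -/
theorem labPat_walkSum_mem_famPat {G₀ G : Fin r → Fin r → Prop} {lab : Fin r → Fin r → M}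
    (hlab : ∀ i j i' j', G₀ i j → G₀ i' j' → lab i j = lab i' j' → i = i' ∧ j = j')
    (hGG₀ : ∀ i j, G i j → G₀ i j) {L : ℕ}
    (hg : ∀ (u : Fin r ⊕ Fin r) (c : (relGraph G).Walk u u), c.IsCycle → 2 * L < c.length)
    {u : Fin r ⊕ Fin r} {c : (relGraph G).Walk u u} (hc : c.IsCycle) (hl : c.length ≤ 4 * L) :
    labPat lab (walkSum dartMat c) ∈ famPat G lab L := by
  have hsupp : ∀ i j, walkSum dartMat c i j ≠ 0 → G₀ i j :=
    fun i j h => hGG₀ i j (rel_of_walkSum_dartMat_ne_zero c h)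
  have htrail : c.IsTrail := hc.isCircuit.isTrail
  unfold famPat
  refine Finset.mem_filter.2 ⟨Finset.mem_image_of_mem _ (walkSum_mem_shortCycleFamily hg hc hl),
    fun h0 => ?_, fun μ => ?_⟩
  · obtain ⟨i, j, hij⟩ : ∃ i j, walkSum dartMat c i j ≠ 0 := by
      by_contra! h
      exact walkSum_dartMat_ne_zero htrail hc.not_nil (Matrix.ext fun i j => h i j)
    have h1 := labPat_apply_lab hlab hsupp hij
    rw [h0, Pi.zero_apply] at h1
    exact hij h1.symm
  · by_cases h : ∃ i j, lab i j = μ ∧ walkSum dartMat c i j ≠ 0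
    · obtain ⟨i, j, rfl, hij⟩ := h
      rw [labPat_apply_lab hlab hsupp hij]
      exact natAbs_walkSum_dartMat_le htrail i j
    · push Not at h
      rw [labPat_eq_zero h]
      simp

/-- ONE ROUND.  Given an oracle answering every family of at most `(r + r) ^ 4` non-zero
height-`≤ 1` patterns `M → ℤ` with GOOD weights `w < 2 ^ ℓ` non-orthogonal to all of them, a
relation `G` inside the read-once relation `G₀` whose graph has girth bound `2L` admits good weights
`w` whose minimum face `nextRel G (labWt lab w)` has girth bound `4L`.
[cite: FennerGurjarThierauf2016, Lemma 3.3 + Lemma 3.5] -/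
theorem exists_round {G₀ G : Fin r → Fin r → Prop} {lab : Fin r → Fin r → M}
    {Good : (M → ℕ) → Prop} {ℓ : ℕ}
    (hlab : ∀ i j i' j', G₀ i j → G₀ i' j' → lab i j = lab i' j' → i = i' ∧ j = j')
    (horacle : ∀ S : Finset (M → ℤ), S.card ≤ (r + r) ^ 4 → (∀ π ∈ S, π ≠ 0) →
      (∀ π ∈ S, ∀ μ, (π μ).natAbs ≤ 1) →
      ∃ w : M → ℕ, Good w ∧ (∀ μ, w μ < 2 ^ ℓ) ∧ ∀ π ∈ S, ∑ μ, π μ * (w μ : ℤ) ≠ 0)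
    (hGG₀ : ∀ i j, G i j → G₀ i j) {L : ℕ}
    (hg : ∀ (u : Fin r ⊕ Fin r) (c : (relGraph G).Walk u u), c.IsCycle → 2 * L < c.length) :
    ∃ w : M → ℕ, Good w ∧ (∀ μ, w μ < 2 ^ ℓ) ∧
      ∀ (u : Fin r ⊕ Fin r) (c : (relGraph (nextRel G (labWt lab w))).Walk u u), c.IsCycle →
        4 * L < c.length := by
  obtain ⟨w, hgood, hlt, hS⟩ := horacle (famPat G lab L) (card_famPat_le G lab L)
    (fun π hπ => ne_zero_of_mem_famPat hπ) (fun π hπ => natAbs_le_of_mem_famPat hπ)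
  refine ⟨w, hgood, hlt, girth_nextRel (labWt lab w) fun u c hc hl => ?_⟩
  have key := hS _ (labPat_walkSum_mem_famPat hlab hGG₀ hg hc hl)
  rw [sum_labPat_mul] at key
  simpa only [labWt_apply] using key

end Round

end Summit.ValiantsHypothesis.ValiantsHypothesis.Theorems.IsolationRoundStep
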